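import Summits.QuantumFields.YangMills.Theorems.InfiniteVolumePerOrderSlackLargeTorusScheme
import Summits.QuantumFields.YangMills.Theorems.InfiniteVolumePerOrderSlackLargeCentreBase
import Summits.QuantumFields.YangMills.Theorems.InfiniteVolumeSchwingerData
import Summits.QuantumFields.YangMills.Theorems.LangevinControlUVOSLegsFromFemtoAndGapStubAssemblyNontrivial
import Summits.QuantumFields.YangMills.Theorems.LangevinControlUVOSLegsFromFemtoAndGapStubAssemblyDensityExpansion
import HarnessLib

/-!
# Infinite volume by compactness with per-order collar constants, UV SLACK and LARGE TORI ONLY: the one-field Schwinger data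

Support file for `SlackWindow.SlackLargeCalibration` (stmt-QuantumFields-23561; the «third twin»).  Verbatim re-run of the landed slack
engine output `InfiniteVolume.PerOrderSlack.ivData_perOrderSlack` (file `InfiniteVolumePerOrderSlackIVData`, width seat w2 g22) with the slack
per-order torus collar bound `(Cn n/R⁴·((R·a β)⁻¹)^σ)ⁿ` assumed only on LARGE tori `L₀ β ≤ L` (`L₀ : ℝ → ℕ`; the landed statement is the case
`L₀ ≡ 0`), through the slack-large twins `PerOrderSlackLarge.exists_subseq_limit_translate_oddTorusLimitPoints`,
`PerOrderSlackLarge.exists_torusSides_approximating`, `PerOrderSlackLarge.tendsto_base_of_tendsto_centre` — the modification of the LARGE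
twin `InfiniteVolumePerOrderLargeIVData` (width seat w2 g21) applied to the slack twin.  Output unchanged: couplings `β_k → ∞`, odd-torus
limit states, a one-field family `S₁` with the DATA clause, E0, E3, translation invariance on `⁰𝒮`, NT∕NG from `LowerBounds`, and the
explicit per-order bound `‖S₁ n F‖ ≤ 7(A + B·Cn n)ⁿ‖F‖_{(σ+10)n}`.

HONEST FRAMING: soft analysis only; the ceilings are HYPOTHESES; nothing about Bałaban's renormalisation group, reflection positivity,
a mass gap or Clay; no summit is proved (rung R2a plumbing).  Width seat ym-line-sfw-p2-w2 g23.

References: Glimm–Jaffe (1987) §6.1; Osterwalder–Schrader CMP 42 (1975) §2.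
-/

set_option autoImplicit false

noncomputable section

open scoped BigOperators SchwartzMap
open MeasureTheory Filter Topology
open Literature.MathematicalPhysics.QuantumFieldTheory hiding ZdEdge
open Literature.MathematicalPhysics.QuantumLattice
open Literature.MathematicalPhysics.AQFT
open Literature.Probability.LatticeModels (box Site)
open Summit.QuantumFields.YangMills.Cruxes.OSLegsFromFemtoAndGap.DlrCollarTransfer (plane torusE LowerBounds)
open Summit.QuantumFields.YangMills.Theorems.OSLegsFromFemtoAndGap
  (latticeDist latticeDistStr latticeDist_dens_eq_sum_latticeDistStr twoPointNontrivial_of_lowerBounds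
    nonGaussian_of_lowerBounds)

namespace Summit.QuantumFields.YangMills.Theorems.InfiniteVolume.PerOrderSlackLarge

/-- **The one-field Schwinger data of the «`L → ∞` first» route, PER-ORDER ceilings** (verbatim
`InfiniteVolumeContinuum.IVData_holds` with a per-order torus collar bound; E0′ returned as the explicit bound
`‖S₁ n F‖ ≤ 7(A + B·Cn n)ⁿ‖F‖_{(σ+10)n}`). [folklore] -/
theorem ivData_perOrderSlackLarge {G : Type} [Group G] [TopologicalSpace G] [IsTopologicalGroup G] [CompactSpace G]
    [MeasurableSpace G] [BorelSpace G] (r : LatticeRep G) (a : ℝ → ℝ) (hapos : ∀ β, 0 < a β)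
    (ha0 : Tendsto a atTop (𝓝 0)) (hLB : LowerBounds G r a) (Cn : ℕ → ℝ) (σ : ℕ) (L₀ : ℝ → ℕ) {β₄ ℓ₄ : ℝ} (hℓ : 0 < ℓ₄)
    (hC : ∀ n, 0 ≤ Cn n)
    (H : ∀ β : ℝ, β₄ ≤ β →
      ∀ (L n : ℕ) (q : Fin n → Fin 4 × Fin 4) (x : Fin n → (Fin 4 → ℤ)) (R : ℕ), (∀ i, (q i).1 < (q i).2) →
        1 ≤ R → (R : ℝ) * a β ≤ ℓ₄ → 4 * R + 8 ≤ L → L₀ β ≤ L →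
        (∀ i j : Fin n, i ≠ j → ∃ k : Fin 4,
          (2 * (R : ℤ) + 4) ≤ |((((x i k - x j k : ℤ) : ZMod (2 * L + 1))).valMinAbs : ℤ)|) →
        |torusE G r β L (fun U => ∏ i, (plane G r (q i) (x i) U - torusE G r β L (plane G r (q i) (x i))))| ≤
          (Cn n / (R : ℝ) ^ 4 * (((R : ℝ) * a β)⁻¹) ^ σ) ^ n) :
    ∃ (β : ℕ → ℝ) (μ : ℕ → Measure (LGConfig 4 G)) (S₁ : SchwingerFamily (EuclideanSpace ℝ (Fin 4)))
      (T : (n : ℕ) → (Fin n → Fin 4 × Fin 4) → (𝓢((Fin n → EuclideanSpace ℝ (Fin 4)), ℂ) →L[ℂ] ℂ)),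
      (Tendsto β atTop atTop ∧ (∀ k, μ k ∈ oddTorusLimitPoints r (β k)) ∧
        (∀ F : 𝓢((Fin 0 → EuclideanSpace ℝ (Fin 4)), ℂ), S₁ 0 F = F default) ∧
        (∀ F : 𝓢((Fin 1 → EuclideanSpace ℝ (Fin 4)), ℂ), S₁ 1 F = 0) ∧
        (∀ n : ℕ, 2 ≤ n → ∀ F : 𝓢((Fin n → EuclideanSpace ℝ (Fin 4)), ℂ),
          S₁ n F = ∑ q ∈ Fintype.piFinset (fun _ : Fin n => Finset.univ.filter fun p : Fin 4 × Fin 4 => p.1 < p.2),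
            T n q F) ∧
        (∀ n : ℕ, 2 ≤ n → ∀ q : Fin n → Fin 4 × Fin 4, (∀ i, (q i).1 < (q i).2) →
          ∀ F : 𝓢((Fin n → EuclideanSpace ℝ (Fin 4)), ℂ), IsOffDiagonal F →
            Tendsto (fun k => ∑' x : Fin n → (Fin 4 → ℤ), ((stateMomentStr G r (μ k) n q x : ℝ) : ℂ) *
              F (fun l => a (β k) • siteToE (x l) +
                (a (β k) / 2) • (EuclideanSpace.single (q l).1 (1 : ℝ) + EuclideanSpace.single (q l).2 (1 : ℝ))))
              atTop (𝓝 (T n q F)))) ∧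
      S₁.toLabelled.IsNormalized ∧
      (∃ A B : ℝ, 0 ≤ A ∧ 0 ≤ B ∧ ∀ (n : ℕ) (F : 𝓢((Fin n → EuclideanSpace ℝ (Fin 4)), ℂ)),
        ‖S₁ n F‖ ≤ 7 * (A + B * Cn n) ^ n * schwartzNorm ((σ + 10) * n) F) ∧
      S₁.toLabelled.IsSymmetric ∧
      (∀ (n : ℕ) (t : EuclideanSpace ℝ (Fin 4)) (F : 𝓢((Fin n → EuclideanSpace ℝ (Fin 4)), ℂ)), IsOffDiagonal F →
        S₁ n (translateMulti t F) = S₁ n F) ∧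
      (∃ (F₁ G₁ : 𝓢((Fin 1 → EuclideanSpace ℝ (Fin 4)), ℂ)) (H₁ : 𝓢((Fin (1 + 1) → EuclideanSpace ℝ (Fin 4)), ℂ)),
        IsTimeOrdered F₁ ∧ IsTimeOrdered G₁ ∧ IsAppendTensorOf H₁ (osAdjoint F₁) G₁ ∧
          S₁.toLabelled (1 + 1) (fun _ => ()) H₁ ≠
            S₁.toLabelled 1 (fun _ => ()) (osAdjoint F₁) * S₁.toLabelled 1 (fun _ => ()) G₁) ∧
      (∃ (f g h : 𝓢(EuclideanSpace ℝ (Fin 4), ℂ)) (Ffgh : 𝓢((Fin 3 → EuclideanSpace ℝ (Fin 4)), ℂ))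
        (Fgh Ffh Ffg : 𝓢((Fin 2 → EuclideanSpace ℝ (Fin 4)), ℂ)) (Ff Fg Fh : 𝓢((Fin 1 → EuclideanSpace ℝ (Fin 4)), ℂ)),
        IsTensorOf Ffgh ![f, g, h] ∧ IsOffDiagonal Ffgh ∧ IsTensorOf Fgh ![g, h] ∧ IsTensorOf Ffh ![f, h] ∧
          IsTensorOf Ffg ![f, g] ∧ IsTensorOf Ff ![f] ∧ IsTensorOf Fg ![g] ∧ IsTensorOf Fh ![h] ∧
          S₁.toLabelled 3 (fun _ => ()) Ffgh - S₁.toLabelled 1 (fun _ => ()) Ff * S₁.toLabelled 2 (fun _ => ()) Fgh -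
              S₁.toLabelled 1 (fun _ => ()) Fg * S₁.toLabelled 2 (fun _ => ()) Ffh -
              S₁.toLabelled 1 (fun _ => ()) Fh * S₁.toLabelled 2 (fun _ => ()) Ffg +
              2 * (S₁.toLabelled 1 (fun _ => ()) Ff * S₁.toLabelled 1 (fun _ => ()) Fg *
                S₁.toLabelled 1 (fun _ => ()) Fh) ≠ 0) := by
  classical
  -- 0. constants of the three engines (per order)
  obtain ⟨Cp, hCp0, Hex⟩ := exists_subseq_limit_translate_oddTorusLimitPoints r Cn σ L₀ hℓ hC H
  have Hjun := exists_torusSides_approximating r Cn σ L₀ hℓ hC H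
  obtain ⟨K, hKdef⟩ : ∃ K : ℕ → ℝ, ∀ n, K n = ((Cp + Cp) * 4 ^ 4 * 5 ^ 6 + (Cp + Cp) * 2 ^ 6 * (10 + 2 * 6) ^ 4 +
      2 ^ (σ + 11) * Cn n * (2 / ℓ₄ + 48) ^ (σ + 4)) * 2 ^ 6 * (81 * ∑' m : ℕ, (((m : ℝ) + 1) ^ 2)⁻¹) := ⟨_, fun n => rfl⟩
  have htsum0 : 0 ≤ ∑' m : ℕ, (((m : ℝ) + 1) ^ 2)⁻¹ := tsum_nonneg fun m => by positivity
  have hK0 : ∀ n, 0 ≤ K n := fun n => by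
    have := hC n
    rw [hKdef]
    positivity
  -- 1. couplings above every threshold, with `a` below every threshold
  obtain ⟨B₁, hB₁⟩ : ∃ B₁ : ℝ, ∀ b, B₁ ≤ b → a b < min (1 / 24) ℓ₄ :=
    Filter.eventually_atTop.1 (ha0.eventually (gt_mem_nhds (by positivity)))
  set βs : ℕ → ℝ := fun k => max β₄ B₁ + (k : ℝ) with hβs
  have hβs4 : ∀ k, β₄ ≤ βs k := fun k => by
    simp only [hβs]; linarith [le_max_left β₄ B₁, (Nat.cast_nonneg k : (0 : ℝ) ≤ k)]
  have hβsB : ∀ k, B₁ ≤ βs k := fun k => by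
    simp only [hβs]
    linarith [le_max_right β₄ B₁, (Nat.cast_nonneg k : (0 : ℝ) ≤ k)]
  have hβs_top : Tendsto βs atTop atTop := tendsto_atTop_add_const_left atTop _ tendsto_natCast_atTop_atTop
  have ha_pos : ∀ k, 0 < a (βs k) := fun k => hapos _
  have ha_24 : ∀ k, a (βs k) ≤ 1 / 24 := fun k => (hB₁ _ (hβsB k)).le.trans (min_le_left _ _)
  have ha_ℓ : ∀ k, a (βs k) ≤ ℓ₄ := fun k => (hB₁ _ (hβsB k)).le.trans (min_le_right _ _)
  have ha_top : Tendsto (fun k => a (βs k)) atTop (𝓝 0) := ha0.comp hβs_top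
  -- thermodynamic limit states along one odd-torus sequence
  obtain ⟨S, -, μ, hμ⟩ := exists_strictMono_forall_mem_oddTorusLimitPoints r βs
  have hμmem : ∀ k, μ k ∈ oddTorusLimitPoints r (βs k) := fun k => (hμ k).2.1
  -- 2. torus sides from the junction (base points)
  obtain ⟨L, -, hL14, -, hLconv⟩ := Hjun βs hβs4 ha_pos ha_24 ha_ℓ μ hμmem (fun _ => 0)
  -- 3. the compactness step with translations for the centre offsets
  set o : ℕ → (n : ℕ) → (Fin n → Fin 4 × Fin 4) → Fin n → EuclideanSpace ℝ (Fin 4) := fun k n q l =>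
    (a (βs k) / 2) • (EuclideanSpace.single (q l).1 (1 : ℝ) + EuclideanSpace.single (q l).2 (1 : ℝ)) with ho
  have hob : ∀ k n (q : Fin n → Fin 4 × Fin 4) l, ‖o k n q l‖ ≤ 5 * a (βs k) := fun k n q l =>
    norm_centreOffset_le (ha_pos k).le (q l)
  obtain ⟨φ, hφ, T, hTb, hconv, htrans⟩ := Hex βs hβs4 ha_pos ha_24 ha_ℓ ha_top μ hμmem o hob
  -- 4. the one-field family
  let P : (n : ℕ) → Finset (Fin n → Fin 4 × Fin 4) := fun n =>
    Fintype.piFinset (fun _ : Fin n => Finset.univ.filter fun p : Fin 4 × Fin 4 => p.1 < p.2)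
  let S₁ : SchwingerFamily (EuclideanSpace ℝ (Fin 4)) := fun n =>
    if n = 0 then LabelledSchwingerFamily.evalAt default else if n = 1 then 0 else ∑ q ∈ P n, T n q
  have hS₁0' : S₁ 0 = LabelledSchwingerFamily.evalAt default := rfl
  have hS₁1' : S₁ 1 = 0 := rfl
  have hS₁0 : ∀ F : 𝓢((Fin 0 → EuclideanSpace ℝ (Fin 4)), ℂ), S₁ 0 F = F default := fun F => by
    rw [hS₁0', LabelledSchwingerFamily.evalAt_apply]
  have hS₁1 : ∀ F : 𝓢((Fin 1 → EuclideanSpace ℝ (Fin 4)), ℂ), S₁ 1 F = 0 := fun F => by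
    rw [hS₁1']; rfl
  have hS₁2 : ∀ n : ℕ, 2 ≤ n → ∀ F : 𝓢((Fin n → EuclideanSpace ℝ (Fin 4)), ℂ),
      S₁ n F = ∑ q ∈ P n, T n q F := fun n hn F => by
    have h : S₁ n = ∑ q ∈ P n, T n q := by
      simp only [S₁, if_neg (show n ≠ 0 by omega), if_neg (show n ≠ 1 by omega)]
    rw [h, FunLike.coe_sum, Finset.sum_apply]
  have hmemP : ∀ n (q : Fin n → Fin 4 × Fin 4), q ∈ P n → ∀ i, (q i).1 < (q i).2 := fun n q hq i => by
    have := (Fintype.mem_piFinset.1 hq) i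
    exact (Finset.mem_filter.1 this).2
  -- the scheme along `φ`
  have hβφ : Tendsto (fun j => βs (φ j)) atTop atTop := hβs_top.comp hφ.tendsto_atTop
  have haφ0 : Tendsto (fun j => a (βs (φ j))) atTop (𝓝 0) := ha_top.comp hφ.tendsto_atTop
  -- the DATA convergence clause (centres) along `φ`
  have hconvC : ∀ n : ℕ, 2 ≤ n → ∀ q : Fin n → Fin 4 × Fin 4, (∀ i, (q i).1 < (q i).2) →
      ∀ F : 𝓢((Fin n → EuclideanSpace ℝ (Fin 4)), ℂ), IsOffDiagonal F →
        Tendsto (fun k => ∑' x : Fin n → (Fin 4 → ℤ), ((stateMomentStr G r (μ (φ k)) n q x : ℝ) : ℂ) *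
          F (fun l => a (βs (φ k)) • siteToE (x l) +
            (a (βs (φ k)) / 2) • (EuclideanSpace.single (q l).1 (1 : ℝ) + EuclideanSpace.single (q l).2 (1 : ℝ))))
          atTop (𝓝 (T n q F)) := fun n hn q hq F hF => hconv n hn q hq F hF
  -- 5a. base-point series along `φ` have the same limits
  have hconvB : ∀ n : ℕ, 2 ≤ n → ∀ q : Fin n → Fin 4 × Fin 4, (∀ i, (q i).1 < (q i).2) →
      ∀ F : 𝓢((Fin n → EuclideanSpace ℝ (Fin 4)), ℂ), IsOffDiagonal F →
        Tendsto (fun k => ∑' x : Fin n → (Fin 4 → ℤ), ((stateMomentStr G r (μ (φ k)) n q x : ℝ) : ℂ) *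
          F (fun l => a (βs (φ k)) • siteToE (x l))) atTop (𝓝 (T n q F)) := fun n hn q hq F hF =>
    tendsto_base_of_tendsto_centre r hapos ha0 Cn σ L₀ hℓ hC H (fun k => βs (φ k)) hβφ (fun k => μ (φ k))
      (fun k => hμmem (φ k)) hn q hq F hF (hconvC n hn q hq F hF)
  -- 5b. the spine's torus plane-string distributions along `(βs ∘ φ, L ∘ φ)` converge to `T n q`
  have hconvT : ∀ n : ℕ, 2 ≤ n → ∀ q : Fin n → Fin 4 × Fin 4, (∀ i, (q i).1 < (q i).2) →
      ∀ F : 𝓢((Fin n → EuclideanSpace ℝ (Fin 4)), ℂ), IsOffDiagonal F →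
        Tendsto (fun j => latticeDistStr r.ρ (βs (φ j)) (L (φ j)) (a (βs (φ j)))
            (fun i U => plaquetteObs r.ρ 0 (q i).1 (q i).2 U)
            (fun i => wilsonTorusMean r.ρ (βs (φ j)) (L (φ j)) (fun U => plaquetteObs r.ρ 0 (q i).1 (q i).2 U)) F)
          atTop (𝓝 (T n q F)) := by
    intro n hn q hq F hF
    have h0 := (hLconv n hn q hq F hF).comp hφ.tendsto_atTop
    have h2 := h0.add (hconvB n hn q hq F hF)
    rw [zero_add] at h2
    refine h2.congr fun j => ?_
    simp only [Function.comp_apply, stateMomentStr, sub_add_cancel]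
  -- 5c. the torus DENSITY functionals converge to `S₁ n`, `n ≥ 2`
  have hconvD : ∀ n : ℕ, 2 ≤ n → ∀ F : 𝓢((Fin n → EuclideanSpace ℝ (Fin 4)), ℂ), IsOffDiagonal F →
      Tendsto (fun j => latticeDist r.ρ (βs (φ j)) (L (φ j)) (a (βs (φ j))) r.curvature.F
        (wilsonTorusMean r.ρ (βs (φ j)) (L (φ j)) r.curvature.F) n F) atTop (𝓝 (S₁ n F)) := by
    intro n hn F hF
    rw [hS₁2 n hn]
    simp_rw [latticeDist_dens_eq_sum_latticeDistStr]
    exact tendsto_finsetSum _ fun q hq => hconvT n hn q (hmemP n q hq) F hF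
  -- `a · L → ∞` along `φ`
  have haL : Tendsto (fun j => a (βs (φ j)) * (L (φ j) : ℝ)) atTop atTop := by
    have h1 : Tendsto (fun j => (a (βs (φ j)))⁻¹) atTop atTop :=
      tendsto_inv_nhdsGT_zero.comp (tendsto_nhdsWithin_iff.2 ⟨haφ0, Eventually.of_forall fun j => ha_pos _⟩)
    refine tendsto_atTop_mono (fun j => ?_) h1
    have := mul_le_mul_of_nonneg_left (hL14 (φ j)).2 (ha_pos (φ j)).le
    rwa [← mul_assoc, mul_inv_cancel₀ (ha_pos (φ j)).ne', one_mul] at this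
  -- NT and NG from the floors (spine toolkit XI-b)
  have hNT := twoPointNontrivial_of_lowerBounds r hLB.1 (fun j => βs (φ j)) (fun j => L (φ j)) hβφ haL S₁ hS₁1
    (hconvD 2 le_rfl)
  have hNG := nonGaussian_of_lowerBounds r hLB.2 (fun j => βs (φ j)) (fun j => L (φ j)) hβφ haL S₁ hS₁1
    (hconvD 3 (by norm_num))
  -- per-order E0′ bounds
  have hbdS₁ : ∀ n (F : 𝓢((Fin n → EuclideanSpace ℝ (Fin 4)), ℂ)),
      ‖S₁ n F‖ ≤ 7 * (6 * K n) ^ n * schwartzNorm ((σ + 10) * n) F := by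
    intro n F
    rcases Nat.lt_or_ge n 2 with hn | hn
    · interval_cases n
      · rw [hS₁0]
        have h1 := norm_le_schwartzNorm 0 F default
        have h0 := schwartzNorm_nonneg 0 F
        simp only [pow_zero, mul_one, mul_zero]
        linarith
      · rw [hS₁1, norm_zero]; exact mul_nonneg (mul_nonneg (by norm_num) (pow_nonneg (by linarith [hK0 1]) _))
          (schwartzNorm_nonneg _ _)
    · rw [hS₁2 n hn]
      have hTb' : ∀ q : Fin n → Fin 4 × Fin 4, ‖T n q F‖ ≤ 7 * K n ^ n * schwartzNorm ((σ + 10) * n) F := fun q => by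
        rw [hKdef]
        exact hTb n q F
      calc _ ≤ ∑ q ∈ P n, ‖T n q F‖ := norm_sum_le _ _
        _ ≤ ∑ _q ∈ P n, 7 * K n ^ n * schwartzNorm ((σ + 10) * n) F := Finset.sum_le_sum fun q _ => hTb' q
        _ = 6 ^ n * (7 * K n ^ n * schwartzNorm ((σ + 10) * n) F) := by
            rw [Finset.sum_const, nsmul_eq_mul, card_validStrings]
        _ = 7 * (6 * K n) ^ n * schwartzNorm ((σ + 10) * n) F := by rw [mul_pow]; ring
  -- 6. assemble
  refine ⟨fun k => βs (φ k), fun k => μ (φ k), S₁, T, ⟨hβφ, fun k => hμmem (φ k), hS₁0, hS₁1, hS₁2, hconvC⟩,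
    fun _ F => ?_, ?_, ?_, ?_, hNT, hNG⟩
  · -- E0
    rw [SchwingerFamily.toLabelled_apply, hS₁0]
    exact congrArg F (Subsingleton.elim _ _)
  · -- per-order E0′: `6 K n = A + B Cn n`
    refine ⟨6 * (((Cp + Cp) * 4 ^ 4 * 5 ^ 6 + (Cp + Cp) * 2 ^ 6 * (10 + 2 * 6) ^ 4) * 2 ^ 6 *
        (81 * ∑' m : ℕ, (((m : ℝ) + 1) ^ 2)⁻¹)),
      6 * ((2 ^ (σ + 11) * (2 / ℓ₄ + 48) ^ (σ + 4)) * 2 ^ 6 * (81 * ∑' m : ℕ, (((m : ℝ) + 1) ^ 2)⁻¹)),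
      by positivity, by positivity, fun n F => ?_⟩
    have e : 6 * (((Cp + Cp) * 4 ^ 4 * 5 ^ 6 + (Cp + Cp) * 2 ^ 6 * (10 + 2 * 6) ^ 4) * 2 ^ 6 *
          (81 * ∑' m : ℕ, (((m : ℝ) + 1) ^ 2)⁻¹)) +
        6 * ((2 ^ (σ + 11) * (2 / ℓ₄ + 48) ^ (σ + 4)) * 2 ^ 6 * (81 * ∑' m : ℕ, (((m : ℝ) + 1) ^ 2)⁻¹)) * Cn n =
        6 * K n := by
      rw [hKdef]; ring
    rw [e]
    exact hbdS₁ n F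
  · -- E3
    intro n k π F hF
    simp only [SchwingerFamily.toLabelled_apply]
    rcases Nat.lt_or_ge n 2 with hn | hn
    · interval_cases n
      · rw [hS₁0, hS₁0]
        exact (permTest_apply π F default).trans (congrArg F (Subsingleton.elim _ _))
      · rw [hS₁1, hS₁1]
    · rw [hS₁2 n hn, hS₁2 n hn]
      exact sum_limit_permTest_eq r (fun k => μ (φ k)) (fun k => a (βs (φ k)))
        (fun k p => (a (βs (φ k)) / 2) • (EuclideanSpace.single p.1 (1 : ℝ) + EuclideanSpace.single p.2 (1 : ℝ)))
        (fun q F => T n q F) (fun q hq F' hF' => hconv n hn q hq F' hF') π F hF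
  · -- translations
    intro n t F hF
    rcases Nat.lt_or_ge n 2 with hn | hn
    · interval_cases n
      · rw [hS₁0, hS₁0]
        exact (translateMulti_apply t F default).trans (congrArg F (Subsingleton.elim _ _))
      · rw [hS₁1, hS₁1]
    · rw [hS₁2 n hn, hS₁2 n hn]
      exact Finset.sum_congr rfl fun q hq => htrans n hn q (hmemP n q hq) t F hF

end Summit.QuantumFields.YangMills.Theorems.InfiniteVolume.PerOrderSlackLarge

end
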